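import Summits.BirchSwinnertonDyer.BirchSwinnertonDyer.Theorems.ManinLocalTwoThreeStevensXSeries
import Summits.BirchSwinnertonDyer.BirchSwinnertonDyer.Theorems.ManinLocalTwoThreeCDivisionCuspSeries
import Summits.BirchSwinnertonDyer.BirchSwinnertonDyer.Theorems.ManinLocalTwoThreeQExpansionExtension
import Summits.BirchSwinnertonDyer.BirchSwinnertonDyer.Theorems.ManinLocalTwoThreeKummerCubeQExpansionPrinciple
import Literature.NumberTheory.EllipticCurves.EichlerIntegralPolesProofs
import Literature.NumberTheory.ModularForms.SturmCongruenceNorm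
import HarnessLib

/-!
# The `x`-presentation on `Γ₁(N)` has a RATIONAL `q`-expansion (toward Stevens 1982 Thm 1.3.1 (b))
(route `ManinLocalTwoThree`, crux C2 `ManinOddAtFour` stmt-BirchSwinnertonDyer-22967; cell bsd-f2-manin, prover seat p1 gen 22;
`--supports stmt-BirchSwinnertonDyer-22967`; sequel of `…StevensXPresentation` / `…StevensXSeries`)

Let `D₁` be an `X₁(N)`-datum of `W` (`c ≠ 0`, `L₁ = c⁻¹Λ_W`), `G ∈ S_k(Γ₀(N))` an integer-coefficient cusp form and `A` a holomorphic
function with `A = 12·℘_{L₁}(ℰ_f)·G·Δ^a` off the poles (`a ≥ 2`), as produced by `StevensGalois.exists_xPresentation` (after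
multiplying by `Δ²` if necessary).  Since `℘_{L₁}(ℰ_f) = c²℘_{Λ_W}(cℰ_f)` and `𝕢²(℘_{Λ_W}(cℰ_f) − b₂/12)` is a RATIONAL `q`-series
near `i∞` (`StevensGalois.exists_hasSum_qParam_sq_mul_x_intMul`), so is `A` — first near `i∞` (Cauchy products with the integer
series of `Δ^a/𝕢²` and of `G`), then on all of `ℍ` by the `q`-expansion extension principle (`QExpansionExtension`), and finally
`qExpansion 1 A` and `qExpansion N A` have rational coefficients (uniqueness of `q`-expansions; period `N` through period `1`).

* `exists_ratSeries_hasSum` — `A = Σ Sₙ 𝕢₁ⁿ` on `ℍ` with `S ∈ ℚ⟦X⟧`;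
* `ratCast_qExpansion_one_coeff`, `map_qExpansion_nat_eq_self` — for a modular form `A` on `Γ₁(N)` with such a series, the
  `q`- and `q_N`-expansions are rational, hence FIXED by every ring endomorphism `σ` of `ℂ`.

No definitions, no sorry.  BSD is not proved by this file; C2 is not proved by this file.
[cite: ShimuraIATAF1971, Thm. 7.14] [cite: Stevens1982, §1.3] [cite: SilvermanAEC2009, IV.1]
-/

set_option linter.dupNamespace false
set_option autoImplicit false

noncomputable section

open scoped Topology PeriodPair MatrixGroups ModularForm Manifold
open Complex Filter PowerSeries CongruenceSubgroup
open UpperHalfPlane hiding I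
open WeierstrassCurve Literature.NumberTheory.EllipticCurves Literature.NumberTheory.EllipticCurves.ModularForms
open Summit.BirchSwinnertonDyer.BirchSwinnertonDyer.Theorems.ManinLocalTwoThree.KummerCubeSigmaLeaves (hasSum_coeff_mul_pow_mul)

namespace Summit.BirchSwinnertonDyer.BirchSwinnertonDyer.Theorems.ManinLocalTwoThree.StevensGalois

variable {N : ℕ} [NeZero N]

/-! ## §1 Bookkeeping on `ℚ`-series -/

/-- Coefficients of the `ℂ`-image of a rational series. [folklore] -/
private theorem coeff_map_ratCast (A : ℚ⟦X⟧) (m : ℕ) : coeff m (A.map (algebraMap ℚ ℂ)) = ((coeff m A : ℚ) : ℂ) := by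
  rw [coeff_map]; rfl

/-- `HasSum` for the finitely supported series `r·X²`. [folklore] -/
private theorem hasSum_C_mul_X_sq (r q : ℂ) :
    HasSum (fun n : ℕ ↦ coeff n (C r * X ^ 2 : ℂ⟦X⟧) * q ^ n) (r * q ^ 2) := by
  have h : (fun n : ℕ ↦ coeff n (C r * X ^ 2 : ℂ⟦X⟧) * q ^ n) = fun n ↦ if n = 2 then r * q ^ 2 else 0 := by
    funext n
    rw [PowerSeries.coeff_C_mul, PowerSeries.coeff_X_pow]
    split_ifs with h
    · rw [h, mul_one]
    · rw [mul_zero, zero_mul]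
  rw [h]
  exact hasSum_ite_eq 2 _

/-! ## §2 The rational `q`-series of `A` -/

/-- **`A = Σ Sₙ 𝕢₁(τ)ⁿ` on all of `ℍ` with `S ∈ ℚ⟦X⟧`**, for `A` holomorphic with `A = 12·℘_{L₁}(ℰ_f)·G·Δ^a` off the poles
(`a ≥ 2`, `G` integer-coefficient). [cite: ShimuraIATAF1971, Thm. 7.14] [cite: SilvermanAEC2009, IV.1] -/
theorem exists_ratSeries_hasSum {W : WeierstrassCurve ℚ} [W.IsElliptic] (D₁ : Gamma1ParametrizationData W N)
    (hc : (D₁.c : ℂ) ≠ 0) {k : ℤ} {a : ℕ} (ha : 2 ≤ a) (G : CuspForm (Gamma0 N) k) (hGint : ∀ m, ∃ z : ℤ, cuspCoeff G m = z)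
    (A : ℍ → ℂ) (hAhol : MDifferentiable 𝓘(ℂ) 𝓘(ℂ) A)
    (hAeq : ∀ τ : ℍ, eichlerIntegral D₁.f τ ∉ (D₁.L.mulLeft ((D₁.c : ℂ)⁻¹) (inv_ne_zero hc)).lattice →
      12 * ℘[D₁.L.mulLeft ((D₁.c : ℂ)⁻¹) (inv_ne_zero hc)] (eichlerIntegral D₁.f τ) * G τ * ModularForm.discriminant τ ^ a = A τ) :
    ∃ S : ℚ⟦X⟧, ∀ τ : ℍ, HasSum (fun n : ℕ ↦ ((coeff n S : ℚ) : ℂ) * Function.Periodic.qParam 1 (τ : ℂ) ^ n) (A τ) := by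
  classical
  have hf : D₁.f ≠ 0 := D₁.isNewformOf.1.ne_zero
  have hc0 : D₁.c ≠ 0 := by exact_mod_cast hc
  -- the `X₀`-datum with the same `f`, `L`, and the rational series of `𝕢²(℘_{Λ_W}(cℰ_f) − b₂/12)`
  obtain ⟨D₀, hf0, hL0, -, -⟩ := exists_modularParametrizationData_of_gamma1 D₁ hc
  obtain ⟨P, B, hP⟩ := exists_hasSum_qParam_sq_mul_x_intMul W D₀ hc0
  rw [hf0, hL0] at hP
  -- no poles high up
  obtain ⟨T, hT⟩ := exists_forall_eichlerIntegral_smul_notMem D₁.f hf (D₁.L.mulLeft ((D₁.c : ℂ)⁻¹) (inv_ne_zero hc)) 1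
  -- the integer series of `G` and of `Δ^a/𝕢²`
  choose bd hbd using hGint
  set R : ℤ⟦X⟧ := X ^ (a - 2) * formalDeltaUnit ^ a with hR
  set S₁ : ℚ⟦X⟧ := C ((12 : ℚ) * (D₁.c : ℚ) ^ 2) * P + C ((D₁.c : ℚ) ^ 2 * W.b₂) * X ^ 2 with hS₁
  set S : ℚ⟦X⟧ := S₁ * R.map (Int.castRingHom ℚ) * PowerSeries.mk (fun n ↦ (bd n : ℚ)) with hS
  refine ⟨S, ?_⟩
  -- near `i∞`
  have hnear : ∀ τ : ℍ, max B T < τ.im →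
      HasSum (fun n : ℕ ↦ ((coeff n S : ℚ) : ℂ) * Function.Periodic.qParam 1 (τ : ℂ) ^ n) (A τ) := by
    intro τ hτ
    have hBτ : B < τ.im := (le_max_left _ _).trans_lt hτ
    have hTτ : T ≤ τ.im := ((le_max_right _ _).trans hτ.le)
    have hΛ : eichlerIntegral D₁.f τ ∉ (D₁.L.mulLeft ((D₁.c : ℂ)⁻¹) (inv_ne_zero hc)).lattice := by
      simpa using hT τ hTτ
    set q := Function.Periodic.qParam 1 (τ : ℂ) with hq
    have hq0 : q ≠ 0 := Function.Periodic.qParam_ne_zero _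
    -- `℘_{L₁}(ℰ_f) = c²℘_{Λ_W}(cℰ_f)`
    have hhom : ℘[D₁.L.mulLeft ((D₁.c : ℂ)⁻¹) (inv_ne_zero hc)] (eichlerIntegral D₁.f τ) =
        (D₁.c : ℂ) ^ 2 * ℘[D₁.L] ((D₁.c : ℂ) * eichlerIntegral D₁.f τ) := by
      have h := PeriodPair.weierstrassP_mulLeft ((D₁.c : ℂ)⁻¹) (inv_ne_zero hc) D₁.L ((D₁.c : ℂ) * eichlerIntegral D₁.f τ)
      rw [← mul_assoc, inv_mul_cancel₀ hc, one_mul] at h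
      rw [h, inv_pow, inv_inv]
    -- `𝕢²·12℘_{L₁}(ℰ_f) = Σ (S₁)ₙ 𝕢ⁿ`
    have h1 : HasSum (fun n : ℕ ↦ coeff n (S₁.map (algebraMap ℚ ℂ)) * q ^ n)
        (q ^ 2 * (12 * ℘[D₁.L.mulLeft ((D₁.c : ℂ)⁻¹) (inv_ne_zero hc)] (eichlerIntegral D₁.f τ))) := by
      have hPs := (hP τ hBτ).mul_left ((12 : ℂ) * (D₁.c : ℂ) ^ 2)
      have hXs := hasSum_C_mul_X_sq ((D₁.c : ℂ) ^ 2 * (W.b₂ : ℂ)) q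
      have h := hPs.add hXs
      have hfun : (fun n : ℕ ↦ coeff n (S₁.map (algebraMap ℚ ℂ)) * q ^ n) =
          fun n : ℕ ↦ (12 : ℂ) * (D₁.c : ℂ) ^ 2 * (((coeff n P : ℚ) : ℂ) * q ^ n) +
            coeff n (C ((D₁.c : ℂ) ^ 2 * (W.b₂ : ℂ)) * X ^ 2 : ℂ⟦X⟧) * q ^ n := by
        funext n
        rw [hS₁, map_add (PowerSeries.map (algebraMap ℚ ℂ)), map_mul (PowerSeries.map (algebraMap ℚ ℂ)),
          map_mul (PowerSeries.map (algebraMap ℚ ℂ)), map_pow (PowerSeries.map (algebraMap ℚ ℂ)), map_C, map_C, map_X,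
          map_add, add_mul, PowerSeries.coeff_C_mul, coeff_map_ratCast]
        simp only [eq_ratCast]
        push_cast
        ring
      have hval : q ^ 2 * (12 * ℘[D₁.L.mulLeft ((D₁.c : ℂ)⁻¹) (inv_ne_zero hc)] (eichlerIntegral D₁.f τ)) =
          (12 : ℂ) * (D₁.c : ℂ) ^ 2 * (q ^ 2 * (℘[D₁.L] ((D₁.c : ℂ) * eichlerIntegral D₁.f τ) - (W.b₂ : ℂ) / 12)) +
            (D₁.c : ℂ) ^ 2 * (W.b₂ : ℂ) * q ^ 2 := by
        rw [hhom]
        ring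
      rw [hfun, hval]
      exact h
    -- `Δ^a/𝕢² = Σ Rₙ 𝕢ⁿ`
    have hΔ : HasSum (fun m : ℕ ↦ ((coeff m (X * formalDeltaUnit) : ℤ) : ℂ) * q ^ m) (ModularForm.discriminant τ) :=
      Literature.NumberTheory.EllipticCurves.hasSum_X_mul_formalDeltaUnit τ
    have hΔa := CDivCuspGerm.hasSum_intCoeff_pow hΔ a
    have hXR : (X * formalDeltaUnit : ℤ⟦X⟧) ^ a = X ^ 2 * R := by
      rw [hR, mul_pow, ← mul_assoc, ← pow_add, Nat.add_sub_cancel' ha]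
    rw [hXR] at hΔa
    have hRsum := CDivCuspGerm.hasSum_intCoeff_of_X_pow_mul hq0 2 hΔa
    have h2 : HasSum (fun n : ℕ ↦ coeff n ((R.map (Int.castRingHom ℚ)).map (algebraMap ℚ ℂ)) * q ^ n)
        (ModularForm.discriminant τ ^ a / q ^ 2) := by
      convert hRsum using 2 with n
      rw [coeff_map, coeff_map]
      simp
    -- `G = Σ bdₙ 𝕢ⁿ`
    have h3 : HasSum (fun n : ℕ ↦ coeff n ((PowerSeries.mk (fun n ↦ (bd n : ℚ))).map (algebraMap ℚ ℂ)) * q ^ n) (G τ) := by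
      have h := UpperHalfPlane.hasSum_qExpansion one_pos
        (SlashInvariantFormClass.periodic_comp_ofComplex G (one_mem_strictPeriods_coe_gamma0 N))
        (ModularFormClass.holo G) (ModularFormClass.bdd_at_infty G) τ
      have hfun : (fun n : ℕ ↦ coeff n ((PowerSeries.mk (fun n ↦ (bd n : ℚ))).map (algebraMap ℚ ℂ)) * q ^ n) =
          fun n : ℕ ↦ (qExpansion 1 ⇑G).coeff n • Function.Periodic.qParam 1 (τ : ℂ) ^ n := by
        funext n
        rw [coeff_map, coeff_mk, smul_eq_mul, hq]
        change ((algebraMap ℚ ℂ) (bd n : ℚ)) * _ = _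
        rw [show (algebraMap ℚ ℂ) (bd n : ℚ) = (bd n : ℂ) by simp, ← hbd n]
        rfl
      rw [hfun]
      exact h
    -- the product
    have hprod := hasSum_coeff_mul_pow_mul (hasSum_coeff_mul_pow_mul h1 h2) h3
    have hval : q ^ 2 * (12 * ℘[D₁.L.mulLeft ((D₁.c : ℂ)⁻¹) (inv_ne_zero hc)] (eichlerIntegral D₁.f τ)) *
        (ModularForm.discriminant τ ^ a / q ^ 2) * G τ = A τ := by
      rw [← hAeq τ hΛ]
      field_simp
    rw [hval] at hprod
    have hfun : (fun n : ℕ ↦ ((coeff n S : ℚ) : ℂ) * Function.Periodic.qParam 1 (τ : ℂ) ^ n) =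
        fun n : ℕ ↦ coeff n (S₁.map (algebraMap ℚ ℂ) * (R.map (Int.castRingHom ℚ)).map (algebraMap ℚ ℂ) *
          (PowerSeries.mk (fun n ↦ (bd n : ℚ))).map (algebraMap ℚ ℂ)) * q ^ n := by
      funext n
      rw [← coeff_map_ratCast, hS, map_mul (PowerSeries.map (algebraMap ℚ ℂ)), map_mul (PowerSeries.map (algebraMap ℚ ℂ))]
    rw [hfun]
    exact hprod
  -- on all of `ℍ`
  exact QExpansionExtension.hasSum_of_hasSum_of_lt_im hAhol hnear

/-! ## §3 Rational `q`- and `q_N`-expansions of a form on `Γ₁(N)` with a rational series -/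

omit [NeZero N] in
/-- **Rational `q`-expansion** (period `1`) of a modular form on `Γ₁(N)` that is the sum of a rational `q`-series on `ℍ`
(uniqueness of `q`-expansions). [cite: ShimuraIATAF1971, §2.1] -/
theorem ratCast_qExpansion_one_coeff {k : ℤ} (A : ModularForm (Gamma1 N) k) (S : ℚ⟦X⟧)
    (hS : ∀ τ : ℍ, HasSum (fun n : ℕ ↦ ((coeff n S : ℚ) : ℂ) * Function.Periodic.qParam 1 (τ : ℂ) ^ n) (A τ)) (m : ℕ) :
    (qExpansion 1 ⇑A).coeff m = ((coeff m S : ℚ) : ℂ) := by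
  have h1 : (1 : ℝ) ∈ (Gamma1 N : Subgroup (GL (Fin 2) ℝ)).strictPeriods := by
    rw [CongruenceSubgroup.strictPeriods_Gamma1]; exact AddSubgroup.mem_zmultiples _
  refine (ModularFormClass.qExpansion_coeff_unique one_pos h1 (f := A) (c := fun n ↦ ((coeff n S : ℚ) : ℂ)) ?_ m).symm
  intro τ
  simpa [smul_eq_mul] using hS τ

/-- **Rational `q_N`-expansion** of such a form, hence FIXED by every ring endomorphism of `ℂ`.
[cite: ShimuraIATAF1971, §2.1 and §6.2] -/
theorem map_qExpansion_nat_eq_self {k : ℤ} (A : ModularForm (Gamma1 N) k) (S : ℚ⟦X⟧)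
    (hS : ∀ τ : ℍ, HasSum (fun n : ℕ ↦ ((coeff n S : ℚ) : ℂ) * Function.Periodic.qParam 1 (τ : ℂ) ^ n) (A τ))
    (σ : ℂ →+* ℂ) : (qExpansion (N : ℝ) ⇑A).map σ = qExpansion (N : ℝ) ⇑A := by
  ext m
  rw [coeff_map, Literature.NumberTheory.ModularForms.coeff_qExpansion_nat_eq A (CongruenceSubgroup.strictPeriods_Gamma1 N) N m]
  split_ifs
  · rw [ratCast_qExpansion_one_coeff A S hS, map_ratCast]
  · exact map_zero σ

end Summit.BirchSwinnertonDyer.BirchSwinnertonDyer.Theorems.ManinLocalTwoThree.StevensGalois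

end
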